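import Summits.QuantumFields.YangMills.Theorems.PencilRigidityWeakCouplingHypercubicLimitRPPairExpansion
import Summits.QuantumFields.YangMills.Theorems.MirrorModularBoostsHypercubicLimitPlaneLimitsDefs
import Summits.QuantumFields.YangMills.Theorems.MirrorModularBoostsHypercubicLimitClosureHalvesDefs
import Summits.QuantumFields.YangMills.Theorems.LangevinControlUVOSLegsAtWeakCouplingCDefs
import HarnessLib

/-!
# Crux `WeakCouplingHypercubicLimit` (stmt-QuantumFields-16120), line `Sketch`, r10 toolkit: the reflection pairing
of two smeared renormalised plane-string fields as ONE finite sum of the twin's plane-string distributions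
(sub-goal SG-G `rpPair_eq_sum_planeDist`)

Helper file of the lead (c4) for the r10 skeleton `Cruxes/WeakCouplingHypercubicLimit/Lines/Sketch.lean`.  On the
odd torus of side `2L_k+1` at step `k` of a scaling scheme `sch`, the torus pairing `E[conj Y(ΘU) · Y'(U)]` of the
smeared multi-point plane-string functionals `Y = fieldObs a_k ((c_k a_k⁴)ⁿ • F) (m_k/6)`,
`Y' = fieldObs a_k ((c_k a_k⁴)^{n'} • F') (m_k/6)` (OSLegs toolkit XVII) of the RENORMALISED test functions is the
finite sum over all plane strings `Q : Fin (n + n') → Plane` of the twin's renormalised plane-string distributions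
`planeDist r sch k (n + n') Q` (crux `HypercubicLimit`, Defs F) applied to ONE Schwartz function: the OS adjoint of the
slot-wise time-shifted `F` (shift `a_k (1 − [Q (rev l) temporal]) e₀` read off the first block of `Q`) tensored with
`F'`.

Chain: `rpPair_expansion` (SG-B1) → `rpTerm_eq_shifted` (toolkit XIX; the vanishing hypothesis of the scaled test
function follows from the one of `F`) → `rpShifted_eq_latticeDistStr` (SG-B3) per pair of valid strings → pull the two
REAL scalars through `compSubConstCLM`, `osAdjoint` (conjugate-linear), `appendTensor` (bilinear) and `latticeDistStr`
(linear) → reindex the double sum over valid strings as one sum over `Fin (n + n') → Plane`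
(`sum_planeStrings_eq_sum_plane`, `sum_planeStrings₂_eq_sum_plane`) → recognise `planeDist` (`planeSpecies_F`,
`pow_add`).

Refs: OsterwalderSeiler1978 §§2–3; GlimmJaffe1987 §6.1.
-/

noncomputable section

open scoped SchwartzMap BigOperators ComplexConjugate
open MeasureTheory Filter Topology
open Literature.MathematicalPhysics.QuantumFieldTheory Literature.MathematicalPhysics.QuantumLattice
open Literature.MathematicalPhysics.AQFT
open Literature.Probability.LatticeModels (box Site)
open Summit.QuantumFields.YangMills.Cruxes.HypercubicLimit.CouplingResponse
open Summit.QuantumFields.YangMills.Cruxes.OSLegsFromFemtoAndGap.DlrCollarTransfer (plane conn Decay RPPos ConnCS)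
open Summit.QuantumFields.YangMills.Cruxes.OSLegsAtWeakCouplingC.Sketch (Separated)
open Summit.QuantumFields.YangMills.Theorems.OSLegsFromFemtoAndGap

namespace Summit.QuantumFields.YangMills.Theorems.WeakCouplingHypercubicLimit.TraceNormColdPressure

/-! ### Reindexing sums over valid plane strings by maps into `Plane` -/

/-- **Valid plane strings are maps into `Plane`**: a sum over the valid plane strings of length `n` (tuples of pairs
`(μ, ν)` with `μ < ν`) is the sum over all maps `Fin n → Plane` of the summand at the underlying tuple. -/
theorem sum_planeStrings_eq_sum_plane {M : Type*} [AddCommMonoid M] {n : ℕ} (g : (Fin n → Fin 4 × Fin 4) → M) :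
    ∑ q ∈ Fintype.piFinset (fun _ : Fin n => Finset.univ.filter fun pl : Fin 4 × Fin 4 => pl.1 < pl.2), g q =
      ∑ q' : Fin n → Plane, g (fun i => (q' i).1) :=
  Finset.sum_bij' (fun q hq i => (⟨q i, (mem_planeStrings_iff'' q).1 hq i⟩ : Plane)) (fun q' _ i => (q' i).1)
    (fun _ _ => Finset.mem_univ _) (fun q' _ => (mem_planeStrings_iff'' _).2 fun i => (q' i).2)
    (fun _ _ => rfl) (fun _ _ => rfl) (fun _ _ => rfl)

/-- **Pairs of valid plane strings are maps into `Plane` of the total length**: a double sum over the valid plane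
strings of lengths `n` and `n'` is ONE sum over the maps `Q : Fin (n + n') → Plane`, the two strings being read off
the two blocks of `Q` (`Q ∘ Fin.castAdd n'` and `Q ∘ Fin.natAdd n`). -/
theorem sum_planeStrings₂_eq_sum_plane {M : Type*} [AddCommMonoid M] {n n' : ℕ}
    (g : (Fin n → Fin 4 × Fin 4) → (Fin n' → Fin 4 × Fin 4) → M) :
    ∑ q ∈ Fintype.piFinset (fun _ : Fin n => Finset.univ.filter fun pl : Fin 4 × Fin 4 => pl.1 < pl.2),
      ∑ p ∈ Fintype.piFinset (fun _ : Fin n' => Finset.univ.filter fun pl : Fin 4 × Fin 4 => pl.1 < pl.2), g q p =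
    ∑ Q : Fin (n + n') → Plane, g (fun i => (Q (Fin.castAdd n' i)).1) (fun j => (Q (Fin.natAdd n j)).1) := by
  simp only [sum_planeStrings_eq_sum_plane]
  have h := sum_piFinset_append (n := n) (k := n') (Finset.univ : Finset Plane)
    (fun Q => g (fun i => (Q (Fin.castAdd n' i)).1) (fun j => (Q (Fin.natAdd n j)).1))
  simp only [Fintype.piFinset_univ, Fin.append_left, Fin.append_right] at h
  exact h.symm

/-! ### The pairing of two scaled smeared fields as a sum over maps into `Plane` -/

/-- **The reflection pairing of two SCALED smeared plane-string fields** (real scalars `c`, `c'`, one common additive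
normalisation `m`), for a first test function with time support in `(0, ρ]`, `ρ < a L`: it is the sum over all maps
`Q : Fin (n + n') → Plane` of `c c'` times the plane-string lattice distribution of the string of plaquette
observables `Q` applied to `Θ(τ_Q F)* ⊗ F'`, where `τ_Q` shifts slot `l` by `a (1 − [Q (rev l) temporal]) e₀`
(`rpPair_expansion`, `rpTerm_eq_shifted`, `rpShifted_eq_latticeDistStr`, conjugate-linearity, bilinearity and
linearity, and the reindexing `sum_planeStrings₂_eq_sum_plane`). -/
theorem rpPair_smul_eq_sum_latticeDistStr {G : Type} [Group G] [TopologicalSpace G] [IsTopologicalGroup G]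
    [CompactSpace G] [MeasurableSpace G] [BorelSpace G] (r : LatticeRep G) (β : ℝ) (L : ℕ) {a : ℝ} (ha : 0 < a)
    {n n' : ℕ} (F : 𝓢((Fin n → EuclideanSpace ℝ (Fin 4)), ℂ)) (F' : 𝓢((Fin n' → EuclideanSpace ℝ (Fin 4)), ℂ))
    {ρ : ℝ} (hF : ∀ u : Fin n → EuclideanSpace ℝ (Fin 4), (∃ l, u l 0 ≤ 0 ∨ ρ < u l 0) → F u = 0)
    (hρ : ρ < a * L) (m c c' : ℝ) :
    ∫ U, conj (fieldObs r L a ((c : ℂ) • F) (fun _ => m) (GaugeConfig.timeReflect U)) *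
        fieldObs r L a ((c' : ℂ) • F') (fun _ => m) U
      ∂(wilsonMeasure r.ρ β : Measure (GaugeConfig 4 (2 * L + 1) G)) =
    ∑ Q : Fin (n + n') → Plane, (c : ℂ) * ((c' : ℂ) *
      latticeDistStr r.ρ β L a (fun l => plaquetteObs r.ρ 0 (Q l).1.1 (Q l).1.2) (fun _ => m)
        ((osAdjoint (SchwartzMap.compSubConstCLM ℂ
          (fun l : Fin n => -((a * (1 - if (Q (Fin.castAdd n' (Fin.rev l))).1.1 = 0 then 1 else 0)) •
            siteToE (Pi.single (0 : Fin 4) (1 : ℤ)))) F)).appendTensor F')) := by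
  -- the scaled first test function inherits the time-support hypothesis
  have hsF : ∀ u : Fin n → EuclideanSpace ℝ (Fin 4), (∃ l, u l 0 ≤ 0 ∨ ρ < u l 0) → ((c : ℂ) • F) u = 0 :=
    fun u hu => by rw [smul_apply, hF u hu, smul_zero]
  -- SG-B1 (the torus expectation is the integral by definition), toolkit XIX, SG-B3 per pair of valid strings
  refine (rpPair_expansion G r β L a n n' ((c : ℂ) • F) ((c' : ℂ) • F') (fun _ => m)).trans ?_
  rw [rpTerm_eq_shifted r β L ha hρ ((c : ℂ) • F) hsF ((c' : ℂ) • F') (fun _ => m)]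
  refine (Finset.sum_congr rfl fun q _ => Finset.sum_congr rfl fun p _ =>
    rpShifted_eq_latticeDistStr G r β L a n n' q p ((c : ℂ) • F) ((c' : ℂ) • F') (fun _ => m)).trans ?_
  -- one sum over maps into `Plane`
  rw [sum_planeStrings₂_eq_sum_plane]
  refine Finset.sum_congr rfl fun Q _ => ?_
  -- the strings and normalisations of the two blocks, appended, are those of `Q`
  rw [Fin.append_castAdd_natAdd (f := fun l : Fin (n + n') => (Q l).1),
    Fin.append_castAdd_natAdd (f := fun _ : Fin (n + n') => m)]
  -- pull the two real scalars out
  simp only [map_smul, osAdjoint_smul, SchwartzMap.appendTensor_smul_left, SchwartzMap.appendTensor_smul_right,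
    Complex.conj_ofReal, smul_eq_mul]
  exact mul_left_comm _ _ _

/-! ### SG-G -/

/-- **SG-G: the torus reflection pairing of two smeared renormalised plane-string functionals at step `k` is a finite
sum of the twin's renormalised plane-string distributions of ONE Schwartz function.**  For `F` with time support in
`(0, ρ]`, `ρ < a_k L_k`:
`E_k[conj Y(ΘU) Y'(U)] = Σ_{Q : Fin (n+n') → Plane} planeDist_k^{Q} (Θ(τ_Q F)* ⊗ F')`, `τ_Q` the slot-wise time shift
by `a_k (1 − [Q (rev l) temporal]) e₀` of the first block (`rpPair_smul_eq_sum_latticeDistStr` with the scalars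
`(c_k a_k⁴)ⁿ`, `(c_k a_k⁴)^{n'}`, whose product is the normalisation `(c_k a_k⁴)^{n+n'}` of `planeDist`). -/
theorem rpPair_eq_sum_planeDist :
    ∀ (G : Type) [Group G] [TopologicalSpace G] [IsTopologicalGroup G] [CompactSpace G]
      [MeasurableSpace G] [BorelSpace G] (r : LatticeRep G) (sch : SpeciesScheme (YMSpecies G)) (k n n' : ℕ)
      (F : 𝓢((Fin n → EuclideanSpace ℝ (Fin 4)), ℂ)) (F' : 𝓢((Fin n' → EuclideanSpace ℝ (Fin 4)), ℂ)) (ρ : ℝ),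
      (∀ u : Fin n → EuclideanSpace ℝ (Fin 4), (∃ l, u l 0 ≤ 0 ∨ ρ < u l 0) → F u = 0) →
      ρ < sch.a k * sch.L k →
      ∫ U, conj (fieldObs r (sch.L k) (sch.a k)
            ((((sch.c r.curvature k * sch.a k ^ 4) ^ n : ℝ) : ℂ) • F) (fun _ => sch.m r.curvature k / 6)
            (GaugeConfig.timeReflect U)) *
          fieldObs r (sch.L k) (sch.a k)
            ((((sch.c r.curvature k * sch.a k ^ 4) ^ n' : ℝ) : ℂ) • F') (fun _ => sch.m r.curvature k / 6) U
        ∂(wilsonMeasure r.ρ (sch.β k) : Measure (GaugeConfig 4 (2 * sch.L k + 1) G)) =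
      ∑ Q : Fin (n + n') → Plane, planeDist r sch k (n + n') Q
        ((osAdjoint (SchwartzMap.compSubConstCLM ℂ
            (fun l : Fin n => -((sch.a k * (1 - if (Q (Fin.castAdd n' (Fin.rev l))).1.1 = 0 then 1 else 0)) •
              siteToE (Pi.single (0 : Fin 4) (1 : ℤ)))) F)).appendTensor F') := by
  intro G _ _ _ _ _ _ r sch k n n' F F' ρ hF hρ
  rw [rpPair_smul_eq_sum_latticeDistStr r (sch.β k) (sch.L k) (sch.a_pos k) F F' hF hρ
    (sch.m r.curvature k / 6) ((sch.c r.curvature k * sch.a k ^ 4) ^ n) ((sch.c r.curvature k * sch.a k ^ 4) ^ n')]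
  refine Finset.sum_congr rfl fun Q _ => ?_
  simp only [planeDist, smul_apply, smul_eq_mul, pow_add, Complex.ofReal_mul, mul_assoc,
    planeSpecies_F]

end Summit.QuantumFields.YangMills.Theorems.WeakCouplingHypercubicLimit.TraceNormColdPressure

end
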